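import Mathlib
import Literature.MathematicalPhysics.StatisticalMechanics.LennardJonesClusters
import Literature.MathematicalPhysics.StatisticalMechanics.SeparatedShellSums
import Summits.AtomisticToContinuum.Crystallization.Theorems.PricedLinkCensusStackingHingeFarTail
import Summits.AtomisticToContinuum.Crystallization.Theorems.ReggeStarCoercivityZeroDefectDensityTwoShell

/-!
# Local energy budget of a ball in a Lennard-Jones ground state
# (stub `stub_localExcess`, S4 of crux `HullMinimality.LayeredWindows`, line `registered`)

Crux `HullMinimality.LayeredWindows` (item stmt-AtomisticToContinuum-11778).  For a Lennard-Jones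
ground state `x : Fin N → ℝ³`, a centre `c` and a radius `ρ ≥ 1` let
`B = {i : dist (x i) c ≤ ρ}`.  Then

`∑_{i ∈ B} ½ 𝓔ⁱ(x) ≤ E(#B) + C ρ²`

with `𝓔ⁱ = siteEnergy lennardJones x i`, `E(n) = groundStateEnergy lennardJones 3 n` and a
universal constant `C`.

Proof (finite-`N` surgery + area law, all ingredients in the tree).
* surgery (`surgery`): `∑_{p ∈ B} 𝓔ᵖ(x) + ∑_{p ∈ B} ∑_{q ∉ B} V(|x_p - x_q|) ≤ 2 E(#B)` — the
  double sum splits over `B`, `Bᶜ` (`sum_sum_eq_add_compl`), the `Bᶜ`-block is `≥ 2 E(N - #B)`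
  (`two_mul_groundStateEnergy_card_le`) and `E(N) ≤ E(N - #B) + E(#B)`
  (`subadditive_groundStateEnergy_lennardJones`);
* the cross term is `≥ -(1/6) ∑_{p ∈ B} ∑_{q ∉ B} |x_p - x_q|⁻⁶ ≥ -(1/6) C_E ρ²` since
  `V_LJ(r) ≥ -r⁻⁶/6` and by the area law `sum_cross_inv_pow_six_le_of_tail` fed with the far tail
  `PricedHcpWindowsFarTail.stub_farTail` (`cross_inv_pow_six_le`), ground states being
  `1/3`-separated (`ZeroDefectDensity.third_le_dist_of_isGroundState`);
* so `∑_B ½ 𝓔 ≤ E(#B) + (C_E/12) ρ²` (for `B = ∅` everything vanishes, `E(0) = 0`).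
-/

noncomputable section

open scoped BigOperators Classical
open Filter Topology

namespace Summit.AtomisticToContinuum.Crystallization.Theorems.LayeredWindowsLocal

open Literature.MathematicalPhysics.StatisticalMechanics

-- `E3 = EuclideanSpace ℝ (Fin 3)` as the (reducible) library abbreviation, so that the statement of
-- the registered stub reads verbatim as in the lead skeleton without declaring notation here.
open Summit.AtomisticToContinuum.Crystallization.Theorems.ChargedEnergyGapNegative (E3)

/-! ## The cross term -/

/-- **Cross term bound**: for a `δ₀`-separated configuration (`0 < δ₀ ≤ 1`),
`∑_{|y_i - c| ≤ ρ} ∑_{|y_j - c| > ρ} |y_i - y_j|⁻⁶ ≤ C(δ₀) ρ²` for `ρ ≥ 1` (area law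
`sum_cross_inv_pow_six_le_of_tail` of `SeparatedShellSums.lean`, fed with the dyadic far-tail bound
`PricedHcpWindowsFarTail.stub_farTail`). [folklore] -/
theorem cross_inv_pow_six_le : ∀ δ₀ : ℝ, 0 < δ₀ → δ₀ ≤ 1 → ∃ C : ℝ, 0 ≤ C ∧
    ∀ (N : ℕ) (y : Fin N → E3),
    (∀ i j : Fin N, i ≠ j → δ₀ ≤ dist (y i) (y j)) → ∀ (c : E3) (ρ : ℝ),
    1 ≤ ρ → ∑ i ∈ Finset.univ.filter (fun i => dist (y i) c ≤ ρ),
      ∑ j ∈ Finset.univ.filter (fun j => ρ < dist (y j) c), (dist (y i) (y j))⁻¹ ^ 6 ≤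
      C * ρ ^ 2 := by
  -- adapted from Summits/AtomisticToContinuum/Crystallization/Theorems/
  --   SquareWellLayerCakeStackingFaultSparsityFarPaste.lean (`cross_inv_pow_six_le`)
  intro δ₀ hδ₀ hδ₁
  obtain ⟨CT, hCT0, hCT⟩ := PricedHcpWindowsFarTail.stub_farTail δ₀ hδ₀
  refine ⟨108 * δ₀⁻¹ ^ 3 * CT * (δ₀⁻¹ ^ 3 + 2), by positivity, ?_⟩
  intro N y hsep c ρ hρ
  exact sum_cross_inv_pow_six_le_of_tail hδ₀ hδ₁ hCT0 y hsep (hCT N y hsep) c hρ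

/-! ## Surgery -/

/-- **Surgery inequality**: in a Lennard-Jones ground state, for every index set `B`,
`∑_{p ∈ B} 𝓔ᵖ(x) + ∑_{p ∈ B} ∑_{q ∉ B} V(|x_p - x_q|) ≤ 2 E(#B)` (`E(N) ≤ E(N - #B) + E(#B)` by
subadditivity, and the `Bᶜ`-block of the double sum is `≥ 2 E(N - #B)`). [folklore] -/
theorem surgery {N : ℕ} {x : Fin N → E3} (hx : IsGroundState lennardJones x)
    (B : Finset (Fin N)) :
    ∑ p ∈ B, siteEnergy lennardJones x p + ∑ p ∈ B, ∑ q ∈ Bᶜ, lennardJones (dist (x p) (x q)) ≤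
      2 * groundStateEnergy lennardJones 3 B.card := by
  -- adapted from SquareWellLayerCakeStackingFaultSparsityFarPaste.lean (`surgery`)
  classical
  -- site energies are full row sums (the diagonal term is `V_LJ(0) = 0`), split along `B`
  have hsite : ∀ p, siteEnergy lennardJones x p =
      ∑ q ∈ B, lennardJones (dist (x p) (x q)) + ∑ q ∈ Bᶜ, lennardJones (dist (x p) (x q)) := by
    intro p
    unfold siteEnergy
    rw [Finset.sum_add_sum_compl B (fun q => lennardJones (dist (x p) (x q))),
      ← Finset.add_sum_erase Finset.univ _ (Finset.mem_univ p), dist_self, lennardJones_zero,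
      zero_add]
  have hLHS : ∑ p ∈ B, siteEnergy lennardJones x p =
      ∑ p ∈ B, ∑ q ∈ B, lennardJones (dist (x p) (x q)) +
        ∑ p ∈ B, ∑ q ∈ Bᶜ, lennardJones (dist (x p) (x q)) := by
    rw [← Finset.sum_add_distrib]
    exact Finset.sum_congr rfl fun p _ => hsite p
  -- the full double sum is `2 E(N)` and splits into four blocks, the two cross blocks agree
  have h2E : 2 * interactionEnergy lennardJones x = ∑ p, ∑ q, lennardJones (dist (x p) (x q)) :=
    two_mul_interactionEnergy_eq_sum_sum lennardJones lennardJones_zero x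
  have hsplit : ∑ p, ∑ q, lennardJones (dist (x p) (x q)) =
      ∑ p ∈ B, ∑ q ∈ B, lennardJones (dist (x p) (x q)) +
        ∑ p ∈ Bᶜ, ∑ q ∈ Bᶜ, lennardJones (dist (x p) (x q)) +
        (∑ p ∈ B, ∑ q ∈ Bᶜ, lennardJones (dist (x p) (x q)) +
          ∑ p ∈ Bᶜ, ∑ q ∈ B, lennardJones (dist (x p) (x q))) :=
    sum_sum_eq_add_compl (fun p q => lennardJones (dist (x p) (x q))) B
  have hsymm : ∑ p ∈ Bᶜ, ∑ q ∈ B, lennardJones (dist (x p) (x q)) =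
      ∑ p ∈ B, ∑ q ∈ Bᶜ, lennardJones (dist (x p) (x q)) := by
    rw [Finset.sum_comm]
    exact Finset.sum_congr rfl fun p _ => Finset.sum_congr rfl fun q _ => by rw [dist_comm]
  -- the `Bᶜ` block costs at least `2 E(#Bᶜ) = 2 E(N - #B)`
  have hBc := two_mul_groundStateEnergy_card_le lennardJones lennardJones_zero
    neg_one_div_le_lennardJones hx.1 Bᶜ
  have hcardc : Bᶜ.card = N - B.card := by rw [Finset.card_compl, Fintype.card_fin]
  rw [hcardc] at hBc
  have hBN : B.card ≤ N := (Finset.card_le_univ B).trans_eq (Fintype.card_fin N)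
  have hE : interactionEnergy lennardJones x = groundStateEnergy lennardJones 3 N := hx.2
  -- subadditivity: `E(N) ≤ E(N - #B) + E(#B)`
  have hbind : groundStateEnergy lennardJones 3 N ≤
      groundStateEnergy lennardJones 3 (N - B.card) + groundStateEnergy lennardJones 3 B.card := by
    have h : ∀ m n : ℕ, groundStateEnergy lennardJones 3 (m + n) ≤
        groundStateEnergy lennardJones 3 m + groundStateEnergy lennardJones 3 n :=
      subadditive_groundStateEnergy_lennardJones (d := 3) (by norm_num)
    have h' := h (N - B.card) B.card
    rwa [Nat.sub_add_cancel hBN] at h'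
  rw [hLHS]
  linarith [hbind, hBc, h2E, hsplit, hsymm, hE]

/-! ## The stub -/

/-- **Stub S4 `stub_localExcess` (local energy budget of a ball in a ground state).** There is a
constant `C` such that for every Lennard-Jones ground state `x`, every centre `c` and radius
`ρ ≥ 1`, the half site energies of the particles in `B(c, ρ)` sum to at most `E(n) + C ρ²`, `n`
their number: surgery (`E(N) ≤ E(N − n) + E(n)`, the outside block is `≥ 2E(N − n)`) plus the area
law for the attractive cross term (`sum_cross_inv_pow_six_le_of_tail` with `stub_farTail`,
`V ≥ −r⁻⁶/6`, ground states `1/3`-separated). [folklore] -/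
theorem stub_localExcess :
    ∃ C : ℝ, ∀ (N : ℕ) (x : Fin N → E3), IsGroundState lennardJones x → ∀ (c : E3) (ρ : ℝ), 1 ≤ ρ → ∑ i ∈ Finset.univ.filter (fun i : Fin N => dist (x i) c ≤ ρ), (1 / 2 : ℝ) * siteEnergy lennardJones x i ≤ groundStateEnergy lennardJones 3 (Finset.univ.filter (fun i : Fin N => dist (x i) c ≤ ρ)).card + C * ρ ^ 2 := by
  obtain ⟨CE, -, hCE⟩ := cross_inv_pow_six_le (1 / 3) (by norm_num) (by norm_num)
  refine ⟨CE / 12, ?_⟩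
  intro N x hx c ρ hρ
  set B := Finset.univ.filter (fun i : Fin N => dist (x i) c ≤ ρ) with hB_def
  -- separation of ground states
  have hsep : ∀ i j : Fin N, i ≠ j → (1 / 3 : ℝ) ≤ dist (x i) (x j) := fun i j hij =>
    ZeroDefectDensity.third_le_dist_of_isGroundState hx hij
  -- the complement of the ball is the outside
  have hBc : Bᶜ = Finset.univ.filter (fun j : Fin N => ρ < dist (x j) c) := by
    ext j
    simp [hB_def, not_le]
  -- surgery
  have hsur := surgery hx B
  -- `V_LJ(r) ≥ -r⁻⁶/6` (drop the repulsive part)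
  have hV : ∀ r : ℝ, -(1 / 6 * r⁻¹ ^ 6) ≤ lennardJones r := fun r => by
    unfold lennardJones
    have : 0 ≤ (1 / 12 : ℝ) * r⁻¹ ^ 12 := by positivity
    linarith
  -- cross term: termwise, then the area law
  have hcross : -(1 / 6 * (CE * ρ ^ 2)) ≤
      ∑ p ∈ B, ∑ q ∈ Bᶜ, lennardJones (dist (x p) (x q)) := by
    have h1 : ∑ p ∈ B, ∑ q ∈ Bᶜ, -(1 / 6 * (dist (x p) (x q))⁻¹ ^ 6) ≤
        ∑ p ∈ B, ∑ q ∈ Bᶜ, lennardJones (dist (x p) (x q)) :=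
      Finset.sum_le_sum fun p _ => Finset.sum_le_sum fun q _ => hV _
    have h2 : ∑ p ∈ B, ∑ q ∈ Bᶜ, -(1 / 6 * (dist (x p) (x q))⁻¹ ^ 6) =
        -(1 / 6 * ∑ p ∈ B, ∑ q ∈ Bᶜ, (dist (x p) (x q))⁻¹ ^ 6) := by
      rw [Finset.mul_sum, ← Finset.sum_neg_distrib]
      refine Finset.sum_congr rfl fun p _ => ?_
      rw [Finset.mul_sum, ← Finset.sum_neg_distrib]
    have h3 : ∑ p ∈ B, ∑ q ∈ Bᶜ, (dist (x p) (x q))⁻¹ ^ 6 ≤ CE * ρ ^ 2 := by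
      rw [hBc, hB_def]
      exact hCE N x hsep c ρ hρ
    rw [h2] at h1
    linarith
  have hhalf : ∑ i ∈ B, (1 / 2 : ℝ) * siteEnergy lennardJones x i =
      (1 / 2) * ∑ i ∈ B, siteEnergy lennardJones x i := by
    rw [Finset.mul_sum]
  rw [hhalf]
  linarith

end Summit.AtomisticToContinuum.Crystallization.Theorems.LayeredWindowsLocal

end
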